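import Mathlib.GroupTheory.Perm.Basic
import Mathlib.Tactic.Linarith
import Mathlib.Tactic.Ring
import HarnessLib

/-!
# Gangloff–Sablik's distortion layer `Δ`: curves of right-cells and their successor maps

Gangloff–Sablik (J. Anal. Math. 2021, arXiv:1706.01627), §5.4.1 "A subshift inducing
pseudo-coverings by curves": the `ℤ²`-SFT `Δ` on the alphabet `{→, ↓}` with forbidden patterns
"`↓` above `↓`" and `[→ ↓ / → →]`; in a configuration of `Δ` the `→`-cells are organised in
disjoint bi-infinite *curves* going one step right or one step down-right at every column
(`φ(k+1) = φ(k) + (1,0)` or `φ(k) + (1,-1)`), two contiguous curves having gap `0` or `1` in every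
column (a *pseudo-covering by curves*). This layer is the second coordinate of the alphabet
`Ã = (A ∪ {blank}) × {→, ↓}` of the distortion operators `d_A` of §5.4.2, with "blank exactly on
`↓`"; we therefore encode a cell of `Ã` as an `Option A` (`none` = `↓` = blank, `some a` = `→`
carrying `a`) and state everything for configurations `z : ℤ × ℤ → Option A`; coordinates are
`(column, row)`, rows increasing upwards.

* `IsDelta z` — the local rules. DEVIATION FROM THE PRINTED RULES: besides "no `↓` above a `↓`"
  (`below_ne_none`) and the printed `2 × 2` pattern (`left_rule`: a `↓` whose left neighbour is
  `→` has a `↓` diagonally below-left) we ALSO forbid the mirror pattern `[→ → / ↓ →]`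
  (`right_rule`: a `↓` whose right neighbour is `→` has a `↓` diagonally above-right). With the
  two printed patterns alone a chain of `↓`'s may stop on its right (e.g. `↓` exactly at the cells
  `(-k, -k)`, `k ≥ 0`, is admissible) and the `→`-cell right of its end lies on no curve coming
  from the left, so that the pseudo-projection `P(y, δ)_{i,j} = y_{φ_{δ,j}(i)}` of §5.4.2 is not
  defined on all of `Δ`; with the third rule every `→`-cell has exactly one predecessor and one
  successor (`succPerm`), which is what §5.4.2 uses. The smaller subshift only helps: it is still
  an SFT containing the undistorted configurations, and the operator built on it in
  `DistortionOperator.lean` still preserves aperiodicity (Prop. 27).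
* `RC z` — the `→`-cells (`z c ≠ none`).
* `succPerm hz : Equiv.Perm (RC z)` — following a curve one column to the right
  (`(i+1, j)` if that cell is `→`, else `(i+1, j-1)`), with inverse `predFun`;
  `nxtPerm hz : Equiv.Perm (RC z)` — the next `→`-cell above in the same column (the contiguous
  curve above), with inverse `prvFun`; `commute_succPerm_nxtPerm` — curves do not cross, so
  "next curve, then follow" = "follow, then next curve".
* `transPerm` — translation by a period of `z`, commuting with both.
* `exists_nxtPerm_zpow_eq` — the `→`-cells of a column form a single `nxtPerm`-orbit.

## References

* S. Gangloff, M. Sablik, *Quantified block gluing for multidimensional subshifts of finite type: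
  aperiodicity and entropy*, J. Anal. Math. 144 (2021) 21–118, §5.4.1 (arXiv:1706.01627, p. 14).
-/

namespace Literature.Dynamics.SymbolicDynamics.Distortion

variable {A : Type*} {z : ℤ × ℤ → Option A}

/-- **The rules of the distortion layer** for `z : ℤ² → Option A` (`none` = `↓`, `some _` = `→`;
coordinates `(column, row)`): no `↓` directly above a `↓`; a `↓` at `(i+1, j)` whose left
neighbour `(i, j)` is `→` forces a `↓` at `(i, j-1)` (the printed pattern `[→ ↓ / → →]` is
forbidden); and the mirror rule, a `↓` at `(i, j)` whose right neighbour is `→` forces a `↓` at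
`(i+1, j+1)` (NOT printed in the source, see the module docstring).
[cite: GangloffSablik2021, §5.4.1 (arXiv numbering)] -/
structure IsDelta (z : ℤ × ℤ → Option A) : Prop where
  /-- no `↓` above a `↓`: below a `↓` there is a `→` -/
  below_ne_none : ∀ i j : ℤ, z (i, j) = none → z (i, j - 1) ≠ none
  /-- `[→ ↓ / → →]` is forbidden -/
  left_rule : ∀ i j : ℤ, z (i + 1, j) = none → z (i, j) ≠ none → z (i, j - 1) = none
  /-- `[→ → / ↓ →]` is forbidden (mirror rule, added) -/
  right_rule : ∀ i j : ℤ, z (i, j) = none → z (i + 1, j) ≠ none → z (i + 1, j + 1) = none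

/-- Above a `↓` there is a `→`. [cite: GangloffSablik2021, §5.4.1 (arXiv numbering)] -/
theorem IsDelta.above_ne_none (hz : IsDelta z) {i j : ℤ} (h : z (i, j) = none) :
    z (i, j + 1) ≠ none := by
  intro h'
  have := hz.below_ne_none i (j + 1) h'
  rw [add_sub_cancel_right] at this
  exact this h

/-- The `→`-cells of `z` (the cells lying on curves). [cite: GangloffSablik2021, §5.4.1 (arXiv numbering)] -/
abbrev RC (z : ℤ × ℤ → Option A) : Type := {c : ℤ × ℤ // z c ≠ none}

/-! ### Following a curve: one column to the right / to the left -/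

/-- Follow the curve through the `→`-cell `(i, j)` one column to the right: to `(i+1, j)` if that
cell is `→`, else (it is `↓`, and the cell below it is `→`) to `(i+1, j-1)` ("the curve is
shifted downwards in this column"). [cite: GangloffSablik2021, §5.4.1 (arXiv numbering)] -/
def succFun (hz : IsDelta z) (c : RC z) : RC z :=
  if h : z (c.1.1 + 1, c.1.2) = none then ⟨(c.1.1 + 1, c.1.2 - 1), hz.below_ne_none _ _ h⟩
  else ⟨(c.1.1 + 1, c.1.2), h⟩

/-- Follow the curve through the `→`-cell `(i, j)` one column to the left: to `(i-1, j)` if that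
cell is `→`, else to `(i-1, j+1)`. [cite: GangloffSablik2021, §5.4.1 (arXiv numbering)] -/
def predFun (hz : IsDelta z) (c : RC z) : RC z :=
  if h : z (c.1.1 - 1, c.1.2) = none then ⟨(c.1.1 - 1, c.1.2 + 1), hz.above_ne_none h⟩
  else ⟨(c.1.1 - 1, c.1.2), h⟩

/-- `predFun` undoes `succFun` (uses the printed `2 × 2` rule). [cite: GangloffSablik2021, §5.4.1 (arXiv numbering)] -/
theorem predFun_succFun (hz : IsDelta z) (c : RC z) : predFun hz (succFun hz c) = c := by
  obtain ⟨⟨i, j⟩, hc⟩ := c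
  unfold succFun
  dsimp only
  split_ifs with h
  · have h2 : z (i, j - 1) = none := hz.left_rule i j h hc
    unfold predFun
    dsimp only
    rw [dif_pos (by rwa [add_sub_cancel_right])]
    exact Subtype.ext (Prod.ext (by simp) (by simp))
  · unfold predFun
    dsimp only
    rw [dif_neg (by rwa [add_sub_cancel_right])]
    exact Subtype.ext (Prod.ext (by simp) rfl)

/-- `succFun` undoes `predFun` (uses the mirror rule). [cite: GangloffSablik2021, §5.4.1 (arXiv numbering)] -/
theorem succFun_predFun (hz : IsDelta z) (c : RC z) : succFun hz (predFun hz c) = c := by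
  obtain ⟨⟨i, j⟩, hc⟩ := c
  unfold predFun
  dsimp only
  split_ifs with h
  · have h2 : z (i, j + 1) = none := by
      have := hz.right_rule (i - 1) j h
      rw [sub_add_cancel] at this
      exact this hc
    unfold succFun
    dsimp only
    rw [dif_pos (by rwa [sub_add_cancel])]
    exact Subtype.ext (Prod.ext (by simp) (by simp))
  · unfold succFun
    dsimp only
    rw [dif_neg (by rwa [sub_add_cancel])]
    exact Subtype.ext (Prod.ext (by simp) rfl)

/-- **Following curves is a permutation of the `→`-cells**: one column to the right (`succFun`),
inverse one column to the left (`predFun`). [cite: GangloffSablik2021, §5.4.1 (arXiv numbering)] -/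
def succPerm (hz : IsDelta z) : Equiv.Perm (RC z) :=
  ⟨succFun hz, predFun hz, predFun_succFun hz, succFun_predFun hz⟩

/-- [cite: GangloffSablik2021, §5.4.1 (arXiv numbering)] -/
@[simp] theorem succPerm_apply (hz : IsDelta z) (c : RC z) : succPerm hz c = succFun hz c := rfl

/-- [cite: GangloffSablik2021, §5.4.1 (arXiv numbering)] -/
@[simp] theorem succPerm_symm_apply (hz : IsDelta z) (c : RC z) :
    (succPerm hz).symm c = predFun hz c := rfl

/-- Following a curve moves one column to the right. [cite: GangloffSablik2021, §5.4.1 (arXiv numbering)] -/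
theorem succFun_col (hz : IsDelta z) (c : RC z) : (succFun hz c).1.1 = c.1.1 + 1 := by
  unfold succFun
  split_ifs <;> rfl

/-- Following a curve to the right keeps the row or lowers it by one. [cite: GangloffSablik2021, §5.4.1 (arXiv numbering)] -/
theorem succFun_row (hz : IsDelta z) (c : RC z) :
    (succFun hz c).1.2 = c.1.2 ∨ (succFun hz c).1.2 = c.1.2 - 1 := by
  unfold succFun
  split_ifs
  · exact Or.inr rfl
  · exact Or.inl rfl

/-- `predFun` moves one column to the left. [cite: GangloffSablik2021, §5.4.1 (arXiv numbering)] -/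
theorem predFun_col (hz : IsDelta z) (c : RC z) : (predFun hz c).1.1 = c.1.1 - 1 := by
  unfold predFun
  split_ifs <;> rfl

/-- `predFun` keeps the row or raises it by one. [cite: GangloffSablik2021, §5.4.1 (arXiv numbering)] -/
theorem predFun_row (hz : IsDelta z) (c : RC z) :
    (predFun hz c).1.2 = c.1.2 ∨ (predFun hz c).1.2 = c.1.2 + 1 := by
  unfold predFun
  split_ifs
  · exact Or.inr rfl
  · exact Or.inl rfl

/-! ### The contiguous curve above / below -/

/-- The next `→`-cell above the `→`-cell `(i, j)` in its column: `(i, j+1)` if it is `→`, else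
`(i, j+2)` (the cell above a `↓` is `→`): the contiguous curve above, at gap `0` or `1`.
[cite: GangloffSablik2021, §5.4.1 (arXiv numbering)] -/
def nxtFun (hz : IsDelta z) (c : RC z) : RC z :=
  if h : z (c.1.1, c.1.2 + 1) = none then ⟨(c.1.1, c.1.2 + 1 + 1), hz.above_ne_none h⟩
  else ⟨(c.1.1, c.1.2 + 1), h⟩

/-- The next `→`-cell below: `(i, j-1)` if it is `→`, else `(i, j-2)`.
[cite: GangloffSablik2021, §5.4.1 (arXiv numbering)] -/
def prvFun (hz : IsDelta z) (c : RC z) : RC z :=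
  if h : z (c.1.1, c.1.2 - 1) = none then ⟨(c.1.1, c.1.2 - 1 - 1), hz.below_ne_none _ _ h⟩
  else ⟨(c.1.1, c.1.2 - 1), h⟩

/-- [cite: GangloffSablik2021, §5.4.1 (arXiv numbering)] -/
theorem prvFun_nxtFun (hz : IsDelta z) (c : RC z) : prvFun hz (nxtFun hz c) = c := by
  obtain ⟨⟨i, j⟩, hc⟩ := c
  unfold nxtFun
  dsimp only
  split_ifs with h
  · unfold prvFun
    dsimp only
    rw [dif_pos (by rwa [add_sub_cancel_right])]
    exact Subtype.ext (Prod.ext rfl (by simp))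
  · unfold prvFun
    dsimp only
    rw [dif_neg (by rwa [add_sub_cancel_right])]
    exact Subtype.ext (Prod.ext rfl (by simp))

/-- [cite: GangloffSablik2021, §5.4.1 (arXiv numbering)] -/
theorem nxtFun_prvFun (hz : IsDelta z) (c : RC z) : nxtFun hz (prvFun hz c) = c := by
  obtain ⟨⟨i, j⟩, hc⟩ := c
  unfold prvFun
  dsimp only
  split_ifs with h
  · unfold nxtFun
    dsimp only
    rw [dif_pos (by rwa [sub_add_cancel])]
    exact Subtype.ext (Prod.ext rfl (by simp))
  · unfold nxtFun
    dsimp only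
    rw [dif_neg (by rwa [sub_add_cancel])]
    exact Subtype.ext (Prod.ext rfl (by simp))

/-- **Passing to the contiguous curve above is a permutation of the `→`-cells** (inverse: the
contiguous curve below). [cite: GangloffSablik2021, §5.4.1 (arXiv numbering)] -/
def nxtPerm (hz : IsDelta z) : Equiv.Perm (RC z) :=
  ⟨nxtFun hz, prvFun hz, prvFun_nxtFun hz, nxtFun_prvFun hz⟩

/-- [cite: GangloffSablik2021, §5.4.1 (arXiv numbering)] -/
@[simp] theorem nxtPerm_apply (hz : IsDelta z) (c : RC z) : nxtPerm hz c = nxtFun hz c := rfl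

/-- [cite: GangloffSablik2021, §5.4.1 (arXiv numbering)] -/
@[simp] theorem nxtPerm_symm_apply (hz : IsDelta z) (c : RC z) :
    (nxtPerm hz).symm c = prvFun hz c := rfl

/-- `nxtFun` stays in the column. [cite: GangloffSablik2021, §5.4.1 (arXiv numbering)] -/
theorem nxtFun_col (hz : IsDelta z) (c : RC z) : (nxtFun hz c).1.1 = c.1.1 := by
  unfold nxtFun
  split_ifs <;> rfl

/-- `nxtFun` goes up by one or two rows (gap `0` or `1` between contiguous curves).
[cite: GangloffSablik2021, §5.4.1 (arXiv numbering)] -/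
theorem nxtFun_row (hz : IsDelta z) (c : RC z) :
    (nxtFun hz c).1.2 = c.1.2 + 1 ∨ (nxtFun hz c).1.2 = c.1.2 + 2 := by
  unfold nxtFun
  split_ifs
  · right
    show c.1.2 + 1 + 1 = c.1.2 + 2
    ring
  · exact Or.inl rfl

/-- `prvFun` stays in the column. [cite: GangloffSablik2021, §5.4.1 (arXiv numbering)] -/
theorem prvFun_col (hz : IsDelta z) (c : RC z) : (prvFun hz c).1.1 = c.1.1 := by
  unfold prvFun
  split_ifs <;> rfl

/-- `prvFun` goes down by one or two rows. [cite: GangloffSablik2021, §5.4.1 (arXiv numbering)] -/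
theorem prvFun_row (hz : IsDelta z) (c : RC z) :
    (prvFun hz c).1.2 = c.1.2 - 1 ∨ (prvFun hz c).1.2 = c.1.2 - 2 := by
  unfold prvFun
  split_ifs
  · right
    show c.1.2 - 1 - 1 = c.1.2 - 2
    ring
  · exact Or.inl rfl

/-- There is no `→`-cell strictly between a `→`-cell and the next one above it: a `→`-cell `e` of
the column of `c` with `c.row < e.row` satisfies `(nxtFun c).row ≤ e.row`.
[cite: GangloffSablik2021, §5.4.1 (arXiv numbering)] -/
theorem nxtFun_row_le (hz : IsDelta z) (c e : RC z) (hcol : e.1.1 = c.1.1) (hrow : c.1.2 < e.1.2) :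
    (nxtFun hz c).1.2 ≤ e.1.2 := by
  obtain ⟨⟨i, j⟩, hc⟩ := c
  obtain ⟨⟨i', j'⟩, he⟩ := e
  dsimp only at hcol hrow ⊢
  subst hcol
  unfold nxtFun
  dsimp only
  split_ifs with h
  · dsimp only
    by_contra hlt
    have hj' : j' = j + 1 := by omega
    subst hj'
    exact he h
  · dsimp only
    omega

/-! ### Curves do not cross: the two permutations commute -/

/-- Value of `succFun` when the cell to the right is `↓`. [cite: GangloffSablik2021, §5.4.1 (arXiv numbering)] -/
theorem succFun_val_of_eq_none (hz : IsDelta z) (c : RC z) (h : z (c.1.1 + 1, c.1.2) = none) :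
    (succFun hz c).1 = (c.1.1 + 1, c.1.2 - 1) := by
  unfold succFun
  rw [dif_pos h]

/-- Value of `succFun` when the cell to the right is `→`. [cite: GangloffSablik2021, §5.4.1 (arXiv numbering)] -/
theorem succFun_val_of_ne_none (hz : IsDelta z) (c : RC z) (h : z (c.1.1 + 1, c.1.2) ≠ none) :
    (succFun hz c).1 = (c.1.1 + 1, c.1.2) := by
  unfold succFun
  rw [dif_neg h]

/-- Value of `nxtFun` when the cell above is `↓`. [cite: GangloffSablik2021, §5.4.1 (arXiv numbering)] -/
theorem nxtFun_val_of_eq_none (hz : IsDelta z) (c : RC z) (h : z (c.1.1, c.1.2 + 1) = none) :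
    (nxtFun hz c).1 = (c.1.1, c.1.2 + 1 + 1) := by
  unfold nxtFun
  rw [dif_pos h]

/-- Value of `nxtFun` when the cell above is `→`. [cite: GangloffSablik2021, §5.4.1 (arXiv numbering)] -/
theorem nxtFun_val_of_ne_none (hz : IsDelta z) (c : RC z) (h : z (c.1.1, c.1.2 + 1) ≠ none) :
    (nxtFun hz c).1 = (c.1.1, c.1.2 + 1) := by
  unfold nxtFun
  rw [dif_neg h]

/-- **"Next curve above, then follow it right" = "follow right, then next curve above"**: the
successor map between the `→`-cells of consecutive columns is an order isomorphism (curves are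
disjoint and keep their vertical order), so it commutes with "next cell above". Direct proof by
the six local cases allowed by the three rules. [cite: GangloffSablik2021, §5.4.1 (arXiv numbering)] -/
theorem succFun_nxtFun (hz : IsDelta z) (c : RC z) :
    succFun hz (nxtFun hz c) = nxtFun hz (succFun hz c) := by
  obtain ⟨⟨i, j⟩, hc⟩ := c
  apply Subtype.ext
  set c₀ : RC z := ⟨(i, j), hc⟩ with hc₀
  by_cases h1 : z (i, j + 1) = none
  · -- gap above `c`: `nxt c = (i, j+2)`
    have hn : (nxtFun hz c₀).1 = (i, j + 1 + 1) := nxtFun_val_of_eq_none hz c₀ h1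
    by_cases h2 : z (i + 1, j) = none
    · -- the curve through `c` shifts down: `succ c = (i+1, j-1)`
      have hs : (succFun hz c₀).1 = (i + 1, j - 1) := succFun_val_of_eq_none hz c₀ h2
      have h21 : z (i + 1, j + 1) ≠ none := hz.above_ne_none h2
      have h22 : z (i + 1, j + 1 + 1) = none := hz.right_rule i (j + 1) h1 h21
      have hl : z ((nxtFun hz c₀).1.1 + 1, (nxtFun hz c₀).1.2) = none := by rw [hn]; exact h22
      have hr : z ((succFun hz c₀).1.1, (succFun hz c₀).1.2 + 1) = none := by
        rw [hs]; dsimp only; rw [sub_add_cancel]; exact h2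
      rw [succFun_val_of_eq_none hz _ hl, nxtFun_val_of_eq_none hz _ hr, hn, hs]
      exact Prod.ext rfl (by dsimp only; ring)
    · -- the curve through `c` goes straight: `succ c = (i+1, j)`
      have hs : (succFun hz c₀).1 = (i + 1, j) := succFun_val_of_ne_none hz c₀ h2
      by_cases h3 : z (i + 1, j + 1) = none
      · have h31 : z (i + 1, j + 1 + 1) ≠ none := hz.above_ne_none h3
        have hl : z ((nxtFun hz c₀).1.1 + 1, (nxtFun hz c₀).1.2) ≠ none := by rw [hn]; exact h31
        have hr : z ((succFun hz c₀).1.1, (succFun hz c₀).1.2 + 1) = none := by rw [hs]; exact h3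
        rw [succFun_val_of_ne_none hz _ hl, nxtFun_val_of_eq_none hz _ hr, hn, hs]
      · have h32 : z (i + 1, j + 1 + 1) = none := hz.right_rule i (j + 1) h1 h3
        have hl : z ((nxtFun hz c₀).1.1 + 1, (nxtFun hz c₀).1.2) = none := by rw [hn]; exact h32
        have hr : z ((succFun hz c₀).1.1, (succFun hz c₀).1.2 + 1) ≠ none := by rw [hs]; exact h3
        rw [succFun_val_of_eq_none hz _ hl, nxtFun_val_of_ne_none hz _ hr, hn, hs]
        exact Prod.ext rfl (by dsimp only; ring)
  · -- no gap above `c`: `nxt c = (i, j+1)`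
    have hn : (nxtFun hz c₀).1 = (i, j + 1) := nxtFun_val_of_ne_none hz c₀ h1
    by_cases h2 : z (i + 1, j) = none
    · have hs : (succFun hz c₀).1 = (i + 1, j - 1) := succFun_val_of_eq_none hz c₀ h2
      have h21 : z (i + 1, j + 1) ≠ none := hz.above_ne_none h2
      have hl : z ((nxtFun hz c₀).1.1 + 1, (nxtFun hz c₀).1.2) ≠ none := by rw [hn]; exact h21
      have hr : z ((succFun hz c₀).1.1, (succFun hz c₀).1.2 + 1) = none := by
        rw [hs]; dsimp only; rw [sub_add_cancel]; exact h2
      rw [succFun_val_of_ne_none hz _ hl, nxtFun_val_of_eq_none hz _ hr, hn, hs]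
      exact Prod.ext rfl (by dsimp only; ring)
    · have hs : (succFun hz c₀).1 = (i + 1, j) := succFun_val_of_ne_none hz c₀ h2
      -- the printed rule forbids a `↓` at `(i+1, j+1)` here
      have h3 : z (i + 1, j + 1) ≠ none := by
        intro h3
        have := hz.left_rule i (j + 1) h3 h1
        rw [add_sub_cancel_right] at this
        exact hc this
      have hl : z ((nxtFun hz c₀).1.1 + 1, (nxtFun hz c₀).1.2) ≠ none := by rw [hn]; exact h3
      have hr : z ((succFun hz c₀).1.1, (succFun hz c₀).1.2 + 1) ≠ none := by rw [hs]; exact h3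
      rw [succFun_val_of_ne_none hz _ hl, nxtFun_val_of_ne_none hz _ hr, hn, hs]

/-- The two permutations `succPerm` (follow the curve right) and `nxtPerm` (contiguous curve
above) commute. [cite: GangloffSablik2021, §5.4.1 (arXiv numbering)] -/
theorem commute_succPerm_nxtPerm (hz : IsDelta z) : Commute (succPerm hz) (nxtPerm hz) :=
  Equiv.ext fun c => succFun_nxtFun hz c

/-! ### Translation by a period -/

/-- Translation of the `→`-cells by a period `u` of `z`. [folklore] -/
def transPerm {u : ℤ × ℤ} (hu : ∀ c : ℤ × ℤ, z (u + c) = z c) : Equiv.Perm (RC z) where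
  toFun c := ⟨u + c.1, by rw [hu]; exact c.2⟩
  invFun c := ⟨-u + c.1, by rw [← hu, add_neg_cancel_left]; exact c.2⟩
  left_inv c := Subtype.ext (by simp)
  right_inv c := Subtype.ext (by simp)

/-- [folklore] -/
@[simp] theorem transPerm_apply_val {u : ℤ × ℤ} (hu : ∀ c : ℤ × ℤ, z (u + c) = z c) (c : RC z) :
    (transPerm hu c).1 = u + c.1 := rfl

/-- Following curves commutes with translation by a period. [folklore] -/
theorem commute_transPerm_succPerm (hz : IsDelta z) {u : ℤ × ℤ}
    (hu : ∀ c : ℤ × ℤ, z (u + c) = z c) : Commute (transPerm hu) (succPerm hz) := by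
  refine Equiv.ext fun c => Subtype.ext ?_
  obtain ⟨⟨i, j⟩, hc⟩ := c
  obtain ⟨u₁, u₂⟩ := u
  show (u₁, u₂) + (succFun hz ⟨(i, j), hc⟩).1 = (succFun hz ⟨(u₁, u₂) + (i, j), _⟩).1
  have key : z (u₁ + i + 1, u₂ + j) = z (i + 1, j) := by
    rw [← hu (i + 1, j), Prod.mk_add_mk, add_assoc]
  unfold succFun
  dsimp only
  simp only [Prod.mk_add_mk]
  by_cases h : z (i + 1, j) = none
  · rw [dif_pos h, dif_pos (key.trans h)]
    exact Prod.ext (by simp only [Prod.mk_add_mk]; ring) (by simp only [Prod.mk_add_mk]; ring)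
  · rw [dif_neg h, dif_neg (fun h' => h (key.symm.trans h'))]
    exact Prod.ext (by simp only [Prod.mk_add_mk]; ring) rfl

/-- Passing to the contiguous curve commutes with translation by a period. [folklore] -/
theorem commute_transPerm_nxtPerm (hz : IsDelta z) {u : ℤ × ℤ}
    (hu : ∀ c : ℤ × ℤ, z (u + c) = z c) : Commute (transPerm hu) (nxtPerm hz) := by
  refine Equiv.ext fun c => Subtype.ext ?_
  obtain ⟨⟨i, j⟩, hc⟩ := c
  obtain ⟨u₁, u₂⟩ := u
  show (u₁, u₂) + (nxtFun hz ⟨(i, j), hc⟩).1 = (nxtFun hz ⟨(u₁, u₂) + (i, j), _⟩).1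
  have key : z (u₁ + i, u₂ + j + 1) = z (i, j + 1) := by
    rw [← hu (i, j + 1), Prod.mk_add_mk, add_assoc]
  unfold nxtFun
  dsimp only
  simp only [Prod.mk_add_mk]
  by_cases h : z (i, j + 1) = none
  · rw [dif_pos h, dif_pos (key.trans h)]
    exact Prod.ext rfl (by simp only [Prod.mk_add_mk]; ring)
  · rw [dif_neg h, dif_neg (fun h' => h (key.symm.trans h'))]
    exact Prod.ext rfl (by simp only [Prod.mk_add_mk]; ring)

/-! ### The `→`-cells of a column form one orbit of `nxtPerm` -/

/-- Every `→`-cell above `c` in the column of `c` is reached from `c` by iterating `nxtFun`.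
[cite: GangloffSablik2021, §5.4.1 (arXiv numbering)] -/
theorem exists_nxtPerm_pow_eq (hz : IsDelta z) (c e : RC z) (hcol : e.1.1 = c.1.1)
    (hrow : c.1.2 ≤ e.1.2) : ∃ m : ℕ, (nxtPerm hz ^ m) c = e := by
  -- induction on the row distance
  obtain ⟨n, hn⟩ : ∃ n : ℕ, e.1.2 = c.1.2 + n := ⟨(e.1.2 - c.1.2).toNat, by omega⟩
  induction n using Nat.strong_induction_on generalizing e with
  | _ n ih =>
    rcases Nat.eq_zero_or_pos n with rfl | hpos
    · refine ⟨0, ?_⟩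
      rw [pow_zero, Equiv.Perm.coe_one, id_eq]
      exact Subtype.ext (Prod.ext hcol.symm (by simp [hn]))
    · -- the `→`-cell below `e` is still at least at the row of `c`
      have hpc := prvFun_col hz e
      have hpr := prvFun_row hz e
      have hle : c.1.2 ≤ (prvFun hz e).1.2 := by
        rcases hpr with h | h
        · omega
        · -- `prvFun e = (i, e.row - 2)`, so `z (i, e.row - 1) = none`; this cell is not `c`
          by_contra hlt
          have hce : c.1.2 = e.1.2 - 1 := by omega
          have hnone : z (e.1.1, e.1.2 - 1) = none := by
            by_contra hsome
            have : (prvFun hz e).1 = (e.1.1, e.1.2 - 1) := by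
              unfold prvFun; rw [dif_neg hsome]
            rw [this] at h
            dsimp only at h
            omega
          apply c.2
          have hc1 : c.1 = (e.1.1, e.1.2 - 1) := Prod.ext hcol.symm hce
          rw [hc1]
          exact hnone
      obtain ⟨n', hn'⟩ : ∃ n' : ℕ, (prvFun hz e).1.2 = c.1.2 + n' :=
        ⟨((prvFun hz e).1.2 - c.1.2).toNat, by omega⟩
      have hn'lt : n' < n := by rcases hpr with h | h <;> omega
      obtain ⟨m, hm⟩ := ih n' hn'lt (prvFun hz e) (hpc.trans hcol) hle hn'
      refine ⟨m + 1, ?_⟩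
      rw [pow_succ', Equiv.Perm.coe_mul, Function.comp_apply, hm]
      exact nxtFun_prvFun hz e

/-- **The `→`-cells of a column form a single orbit of `nxtPerm`**: any two `→`-cells of the
same column are related by an integer power of "next cell above".
[cite: GangloffSablik2021, §5.4.1 (arXiv numbering)] -/
theorem exists_nxtPerm_zpow_eq (hz : IsDelta z) (c e : RC z) (hcol : e.1.1 = c.1.1) :
    ∃ m : ℤ, (nxtPerm hz ^ m) c = e := by
  rcases le_total c.1.2 e.1.2 with h | h
  · obtain ⟨m, hm⟩ := exists_nxtPerm_pow_eq hz c e hcol h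
    exact ⟨m, by exact_mod_cast hm⟩
  · obtain ⟨m, hm⟩ := exists_nxtPerm_pow_eq hz e c hcol.symm h
    refine ⟨-m, ?_⟩
    rw [zpow_neg, zpow_natCast, Equiv.Perm.inv_def, Equiv.symm_apply_eq]
    exact hm.symm

end Literature.Dynamics.SymbolicDynamics.Distortion
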